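import Summits.Ventures.PercRepro.RankLevelSetBiIndepUpSet

/-! # RankLevelSetInOutK24 — THE CELL'S (IO) FOR ARBITRARY FILTERS OF FLATS IS FALSE: THE CYCLE MATROID OF `K_{2,4}`
WITH THE FILTER «FLATS CONTAINING ONE OF THE TWO EDGES AT A DEGREE-2 VERTEX» HAS IN-OUT PROFILE `(0,0,0,0,12,8,0,0,0)`,
AND `12 > 8` BREAKS THE REFLECTION PAIR `(4, 5)` OF `NormSkew (·; 9)` (night-1 g33; dossier §45.11; COMPUTATIONAL: the
matroid axioms and the two counts are checked by `native_decide`)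

`k24` is the cycle matroid of the complete bipartite graph `K_{2,4}` (= the theta graph `Θ(2,2,2,2)`: two hubs joined
by four paths of length 2); the edges are `Fin 8`, the paths are the pairs `{0,1}, {2,3}, {4,5}, {6,7}` (`classes`),
and an edge set is a forest iff it contains at most one whole path (`k24Indep`; two whole paths form a 4-cycle). It is
simple, of rank 5, NOT paving. The family `cutPair = {F : 0 ∈ cl F ∨ 1 ∈ cl F}` — the union of the cuts of the two
edges of one path — is up-closed among the flats (`upSetFlats_cutPair`) but is NOT a modular cut. Its in-out profile
`a_k = #{W ∈ D_k : cl W ∈ cutPair, cl (E ∖ W) ∉ cutPair}` has `a_4 = 12` and `a_5 = 8` (`inOutCount_four`,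
`inOutCount_five`), so `a_4 · C(9, 5) = 1512 > 1008 = a_5 · C(9, 4)`: **`not_biIndepInOutNormSkew_k24 :
¬ BiIndepInOutNormSkew k24`**. This refutes the arbitrary-filter form of (IO) (g32's `BiIndepInOutNormSkew`, dossier
§44.3: «the modular-cut axiom is idle») at the smallest possible size: every matroid on ≤ 7 elements with every filter of
its lattice of flats (lattices ≤ 14 flats; principal and 2-generated filters beyond) satisfies (IO) (night-1 g33 census,
561,026 steps), and on 8 elements the 19 failing (matroid, filter) pairs among 3,335,405 are all unions of two element
cuts (kit j322960, mining/night-1/g33/iocuts8.py), while every principal filter (37,547), every element cut (2,386) and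
every intersection of two cuts (8,913) is clean. The MODULAR-CUT form of (IO) — and (ABS-norm), which is (IO) on the
deletions with the cut of an element — is untouched (0 / 42,981,750 on n = 9, g32). Every declaration has a
docstring; imports: the cell's own modules and Mathlib only. Axioms: standard plus `Lean.ofReduceBool`
(`native_decide`) on the computational declarations. -/

namespace PercRepro

namespace K24

open Set Matroid

/-- The four paths of `K_{2,4}` as pairs of edges. -/
def classes : List (Finset (Fin 8)) := [{0, 1}, {2, 3}, {4, 5}, {6, 7}]

/-- The number of whole paths contained in an edge set. -/
def fullCount (S : Finset (Fin 8)) : ℕ := (classes.filter (fun C => C ⊆ S)).length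

/-- **The forests of `K_{2,4}`**: edge sets containing at most one whole path. -/
abbrev k24Indep (S : Finset (Fin 8)) : Prop := fullCount S ≤ 1

/-- The empty set is a forest. -/
theorem k24Indep_empty : k24Indep ∅ := by decide

/-- Subsets of forests are forests (checked over all pairs of edge sets). -/
theorem k24Indep_subset : ∀ ⦃I J : Finset (Fin 8)⦄, k24Indep J → I ⊆ J → k24Indep I := by
  native_decide

/-- The augmentation axiom for the forests of `K_{2,4}` (checked over all pairs of edge sets). -/
theorem k24Indep_aug : ∀ ⦃I J : Finset (Fin 8)⦄, k24Indep I → k24Indep J → I.card < J.card →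
    ∃ e ∈ J, e ∉ I ∧ k24Indep (insert e I) := by
  native_decide

/-- **The cycle matroid of `K_{2,4}`** on the edge set `Fin 8`. -/
def k24 : Matroid (Fin 8) :=
  (IndepMatroid.ofFinset Set.univ k24Indep k24Indep_empty k24Indep_subset k24Indep_aug
    (fun _ _ => Set.subset_univ _)).matroid

/-- The ground set is every edge. -/
theorem k24_ground : k24.E = Set.univ := rfl

/-- The ground set has 8 elements. -/
theorem k24_ncard : k24.E.ncard = 8 := by
  rw [k24_ground, Set.ncard_univ, Nat.card_eq_fintype_card, Fintype.card_fin]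

/-- `k24` is finite (a theorem, not an instance: the cell's typer lint). -/
theorem k24_finite : k24.Finite := ⟨Set.toFinite _⟩

/-- Independence in `k24` of a finite edge set is the forest predicate. -/
theorem k24_indep_coe (I : Finset (Fin 8)) : k24.Indep (I : Set (Fin 8)) ↔ k24Indep I := by
  unfold k24
  exact IndepMatroid.ofFinset_indep Set.univ k24Indep k24Indep_empty k24Indep_subset k24Indep_aug
    (fun _ _ => Set.subset_univ _)

/-- **The decidable closure test** for a forest `W`: `x ∈ cl W ↔ x ∈ W ∨ insert x W is not a forest`. -/
abbrev inCl (x : Fin 8) (W : Finset (Fin 8)) : Prop := x ∈ W ∨ ¬ k24Indep (insert x W)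

/-- `x ∈ cl W ↔ inCl x W` for a forest `W`. -/
theorem mem_closure_iff_inCl (W : Finset (Fin 8)) (hW : k24Indep W) (x : Fin 8) :
    x ∈ k24.closure (W : Set (Fin 8)) ↔ inCl x W := by
  have hind : k24.Indep (W : Set (Fin 8)) := (k24_indep_coe W).mpr hW
  rw [hind.mem_closure_iff', k24_ground, ← Finset.coe_insert, k24_indep_coe, Finset.mem_coe]
  simp only [Set.mem_univ, true_and, inCl]
  tauto

/-- **The filter**: the flats containing edge `0` or edge `1` in their closure — the union of two element cuts. -/
def cutPair : Set (Set (Fin 8)) := {F | (0 : Fin 8) ∈ k24.closure F ∨ (1 : Fin 8) ∈ k24.closure F}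

/-- `cutPair` is up-closed among the flats of `k24` (indeed among all sets). -/
theorem upSetFlats_cutPair : UpSetFlats k24 cutPair := by
  intro F hF G _ hFG
  rcases hF with h | h
  · exact Or.inl (k24.closure_subset_closure hFG h)
  · exact Or.inr (k24.closure_subset_closure hFG h)

/-- The decidable in-out predicate of a finite edge set `W` (with `W` and `univ ∖ W` forests). -/
abbrev inOutP (W : Finset (Fin 8)) : Prop :=
  (inCl 0 W ∨ inCl 1 W) ∧ ¬ (inCl 0 (Finset.univ \ W) ∨ inCl 1 (Finset.univ \ W))

/-- **The transfer of the in-out count to a `Finset` computation.** -/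
theorem inOutCount_eq (k : ℕ) :
    inOutCount k24 cutPair k = (Finset.univ.filter (fun T : Finset (Fin 8) =>
      (T.card = k ∧ k24Indep T ∧ k24Indep (Finset.univ \ T)) ∧ inOutP T)).card := by
  classical
  unfold inOutCount
  rw [← Set.ncard_coe_finset]
  symm
  refine Set.ncard_congr (fun T _ => (T : Set (Fin 8))) ?_ ?_ ?_
  · rintro T hT
    simp only [Finset.coe_filter, Finset.mem_univ, true_and, Set.mem_setOf_eq] at hT
    obtain ⟨⟨hcard, hind, hcind⟩, hin, hout⟩ := hT
    have hcoe : k24.E \ (T : Set (Fin 8)) = ((Finset.univ \ T : Finset (Fin 8)) : Set (Fin 8)) := by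
      rw [k24_ground, Finset.coe_sdiff, Finset.coe_univ]
    refine ⟨⟨Set.subset_univ _, by rw [Set.ncard_coe_finset]; exact hcard, (k24_indep_coe T).mpr hind, ?_⟩, ?_, ?_⟩
    · rw [hcoe]; exact (k24_indep_coe _).mpr hcind
    · unfold cutPair
      rw [Set.mem_setOf_eq, Matroid.closure_closure, mem_closure_iff_inCl T hind, mem_closure_iff_inCl T hind]
      exact hin
    · unfold cutPair
      rw [hcoe, Set.mem_setOf_eq, Matroid.closure_closure, mem_closure_iff_inCl _ hcind,
        mem_closure_iff_inCl _ hcind]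
      exact hout
  · intro T T' _ _ h
    exact Finset.coe_inj.mp h
  · rintro S ⟨⟨-, hcard, hind, hcind⟩, hin, hout⟩
    have hfin : S.Finite := Set.toFinite S
    refine ⟨hfin.toFinset, ?_, hfin.coe_toFinset⟩
    simp only [Finset.coe_filter, Finset.mem_univ, true_and, Set.mem_setOf_eq]
    have hcoe : k24.E \ S = ((Finset.univ \ hfin.toFinset : Finset (Fin 8)) : Set (Fin 8)) := by
      rw [k24_ground, Finset.coe_sdiff, Finset.coe_univ, hfin.coe_toFinset]
    have hind' : k24Indep hfin.toFinset := by
      rw [← k24_indep_coe, hfin.coe_toFinset]; exact hind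
    have hcind' : k24Indep (Finset.univ \ hfin.toFinset) := by
      rw [← k24_indep_coe, ← hcoe]; exact hcind
    refine ⟨⟨?_, hind', hcind'⟩, ?_, ?_⟩
    · rw [← hcard, Set.ncard_eq_toFinset_card S hfin]
    · unfold cutPair at hin
      rw [Set.mem_setOf_eq, Matroid.closure_closure, ← hfin.coe_toFinset, mem_closure_iff_inCl _ hind',
        mem_closure_iff_inCl _ hind'] at hin
      exact hin
    · unfold cutPair at hout
      rw [Set.mem_setOf_eq, Matroid.closure_closure, hcoe, mem_closure_iff_inCl _ hcind',
        mem_closure_iff_inCl _ hcind'] at hout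
      exact hout

/-- **`a_4 = 12`**: twelve in-out forests with four edges. -/
theorem inOutCount_four : inOutCount k24 cutPair 4 = 12 := by
  rw [inOutCount_eq]; native_decide

/-- **`a_5 = 8`**: eight in-out forests with five edges. -/
theorem inOutCount_five : inOutCount k24 cutPair 5 = 8 := by
  rw [inOutCount_eq]; native_decide

/-- **THE CELL'S (IO) FOR ARBITRARY FILTERS IS FALSE**: `¬ BiIndepInOutNormSkew k24` — the reflection pair `(4, 5)` of
`NormSkew (a; 9)` reads `12 · C(9, 5) ≤ 8 · C(9, 4)`, i.e. `1512 ≤ 1008`. -/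
theorem not_biIndepInOutNormSkew_k24 : ¬ BiIndepInOutNormSkew k24 := by
  intro h
  have := h cutPair upSetFlats_cutPair 4 5 (by norm_num) (by rw [k24_ncard])
  rw [k24_ncard, inOutCount_four, inOutCount_five] at this
  exact absurd this (by decide)

end K24

end PercRepro
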